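import Mathlib.Analysis.SpecialFunctions.Pow.Real
import Mathlib.Algebra.Order.BigOperators.Group.Finset
import Mathlib.Algebra.BigOperators.Ring.Finset
import HarnessLib

/-!
# Line «poincare_lipschitz» on crux `HistoryTailL` (stmt-QuantumFields-19936), route crux `BlockLipschitzL` (stmt-QuantumFields-23533), K2 AT DEPTH,
# (R3) INTERIOR REGULARITY — THE ABSTRACT MULTISCALE PAIRING LEMMA: a kernel against a field that is small ON AVERAGE AT EVERY SCALE is bounded by
# `Σ_scales (kernel oscillation at the next scale) × (averaged size at this scale)`, NOT by `‖kernel‖_{ℓ¹} × sup|field|`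

Cell `ym3-torus` (YM ladder rung R3 = continuum SU(2) Yang–Mills on the three-torus — a RUNG, NOT the Clay problem: not d = 4, not infinite volume, not a
mass gap); width seat `ym3-torus-px7` gen 4, item (C1) of LOCATE «(R3)-LIN» (19936 evidence #44; LEAD ym-ust-19936-w1 g7 «(C) LOCATE→SIGNATURE welcome»,
2026-08-29T00:23:09Z).  Pure finite sums over a `Fintype`; def-free; Mathlib-only imports; `--supports stmt-QuantumFields-23533`.  Nothing here proves
`hStab`, (R3), (R4), a stub, `BlockLipschitzL`, `HistoryTailL` or a summit statement.

WHY (LOCATE §3, card v1.26 (R3)).  In the linear model of (R3) the corrector is `w(x) = Σ_y K(x,y)·F(y)` with `K = ∇(Green)` (`|K| ≍ |x−y|^{−2}`,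
oscillation over a block of side `L^{m+1}` `≍ L^{m+1}|x−y|^{−3}`) and `F` the level-0 curl, of which «both fields good» controls NOT the size (`θ₀` only)
but the MEANS at every scale: `|E_m F| ≤ 2θ₀L^{−3m/2}π_m` (sibling ✓`PoincareLipschitzLinAvgCurlClosedForm.abs_mean_curlAt_le_of_window`), where the
scale-`m` means are linked by averaging operators, `E_{m+1}F = U_m(E_m F)`, `E_0 = id`.  The single-scale bound `‖K‖_{ℓ¹}·θ₀ ≍ L^{j+1}θ₀` hits the
«j ≲ K/2» wall; the multiscale bound below gives `Σ_m (L^{m+1}·L^{−3i})·L^{3i}·θ₀L^{−3m/2} ≲ L·θ₀` per shell.  THIS FILE is the summation skeleton,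
with the averaging operators abstract:

* `sum_mul_sub_avg_eq` — for weights `u y z ≥ 0` with UNIT COLUMN SUMS (`Σ_y u y z = 1`; row sums are not needed):
  `Σ_y K y·(g y − Σ_z u y z·g z) = Σ_z g z·Σ_y u y z·(K z − K y)` — the averaging moves onto the kernel.
* ★ `abs_sum_mul_sub_avg_le` — if `|K z − K y| ≤ ω z` whenever `u y z ≠ 0` (kernel oscillation over the averaging range), then
  `|Σ_y K y·(g y − (Ug) y)| ≤ Σ_z ω z·|g z|`.
* `sum_mul_eq_telescope` — for a chain `E (m+1) = U_m (E m)`: `Σ_y K y·E 0 y = Σ_{m<i} Σ_y K y·(E m y − (U_m (E m)) y) + Σ_y K y·E i y`.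
* ★★ `abs_sum_mul_le_multiscale` — `|Σ_y K y·E 0 y| ≤ Σ_{m<i} Σ_z ω_m z·|E m z| + Σ_y |K y|·|E i y|`.
* ★★ `abs_sum_mul_le_multiscale_sup` — with everything supported in a finset `s`, sup bounds `|E m z| ≤ β m` on `s` give
  `|Σ_y K y·E 0 y| ≤ Σ_{m<i} β m·(Σ_{z∈s} ω_m z) + β i·Σ_{y∈s} |K y|` — the shape LOCATE §3 sums shell by shell.
[folklore] (summation by parts across scales; e.g. the Calderón–Zygmund ∕ Littlewood–Paley bookkeeping behind [Balaban1985Averaging] Props 1–3).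
-/

set_option autoImplicit false

noncomputable section

open scoped BigOperators

namespace Summit.QuantumFields.YangMills.Theorems.PoincareLipschitzMultiscalePairing

variable {ι : Type*} [Fintype ι]

/-! ## §1 One scale: moving the average onto the kernel -/

/-- **THE AVERAGE MOVES ONTO THE KERNEL** (unit column sums): `Σ_y K y·(g y − Σ_z u y z·g z) = Σ_z g z·Σ_y u y z·(K z − K y)`. [folklore] -/
theorem sum_mul_sub_avg_eq (u : ι → ι → ℝ) (hcol : ∀ z, ∑ y, u y z = 1) (K g : ι → ℝ) :
    ∑ y, K y * (g y - ∑ z, u y z * g z) = ∑ z, g z * ∑ y, u y z * (K z - K y) := by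
  have h1 : ∑ y, K y * g y = ∑ z, g z * ∑ y, u y z * K z := by
    refine Finset.sum_congr rfl fun z _ => ?_
    rw [← Finset.sum_mul, hcol z, one_mul, mul_comm]
  have h2 : ∑ y, K y * ∑ z, u y z * g z = ∑ z, g z * ∑ y, u y z * K y := by
    simp_rw [Finset.mul_sum]
    rw [Finset.sum_comm]
    refine Finset.sum_congr rfl fun z _ => Finset.sum_congr rfl fun y _ => by ring
  simp_rw [mul_sub, Finset.sum_sub_distrib, h1, h2, ← Finset.sum_sub_distrib, ← mul_sub, ← Finset.sum_sub_distrib, ← mul_sub]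

/-- ★ **ONE-SCALE PAIRING BOUND**: non-negative weights with unit column sums, kernel oscillation `|K z − K y| ≤ ω z` on the averaging range
(`u y z ≠ 0`) ⟹ `|Σ_y K y·(g y − Σ_z u y z·g z)| ≤ Σ_z ω z·|g z|`. [folklore] -/
theorem abs_sum_mul_sub_avg_le (u : ι → ι → ℝ) (hu : ∀ y z, 0 ≤ u y z) (hcol : ∀ z, ∑ y, u y z = 1) (K g ω : ι → ℝ)
    (hω : ∀ y z, u y z ≠ 0 → |K z - K y| ≤ ω z) :
    |∑ y, K y * (g y - ∑ z, u y z * g z)| ≤ ∑ z, ω z * |g z| := by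
  rw [sum_mul_sub_avg_eq u hcol K g]
  refine (Finset.abs_sum_le_sum_abs _ _).trans (Finset.sum_le_sum fun z _ => ?_)
  rw [abs_mul]
  have hin : |∑ y, u y z * (K z - K y)| ≤ ω z := by
    refine (Finset.abs_sum_le_sum_abs _ _).trans ?_
    have hstep : ∀ y, |u y z * (K z - K y)| ≤ u y z * ω z := by
      intro y
      by_cases h0 : u y z = 0
      · rw [h0]; simp
      · rw [abs_mul, abs_of_nonneg (hu y z)]
        exact mul_le_mul_of_nonneg_left (hω y z h0) (hu y z)
    calc ∑ y, |u y z * (K z - K y)| ≤ ∑ y, u y z * ω z := Finset.sum_le_sum fun y _ => hstep y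
      _ = ω z := by rw [← Finset.sum_mul, hcol z, one_mul]
  calc |g z| * |∑ y, u y z * (K z - K y)| ≤ |g z| * ω z := mul_le_mul_of_nonneg_left hin (abs_nonneg _)
    _ = ω z * |g z| := mul_comm _ _

/-! ## §2 All scales: telescoping along a chain of averaging operators -/

/-- **TELESCOPING ALONG THE CHAIN** `E (m+1) y = Σ_z u m y z·E m z`:
`Σ_y K y·E 0 y = Σ_{m<i} Σ_y K y·(E m y − Σ_z u m y z·E m z) + Σ_y K y·E i y`. [folklore] -/
theorem sum_mul_eq_telescope (u : ℕ → ι → ι → ℝ) (E : ℕ → ι → ℝ) (hE : ∀ m y, E (m + 1) y = ∑ z, u m y z * E m z) (K : ι → ℝ) :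
    ∀ i : ℕ, ∑ y, K y * E 0 y =
      ∑ m ∈ Finset.range i, ∑ y, K y * (E m y - ∑ z, u m y z * E m z) + ∑ y, K y * E i y
  | 0 => by simp
  | i + 1 => by
    rw [Finset.sum_range_succ, sum_mul_eq_telescope u E hE K i]
    have h : ∑ y, K y * E (i + 1) y = ∑ y, K y * ∑ z, u i y z * E i z :=
      Finset.sum_congr rfl fun y _ => by rw [hE i y]
    rw [h]
    simp_rw [mul_sub, Finset.sum_sub_distrib]
    ring

/-- ★★ **THE MULTISCALE PAIRING BOUND.**  Non-negative weights `u m` with unit column sums at every scale, a chain `E (m+1) = U_m (E m)`, and kernel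
oscillations `|K z − K y| ≤ ω m z` whenever `u m y z ≠ 0` ⟹ `|Σ_y K y·E 0 y| ≤ Σ_{m<i} Σ_z ω m z·|E m z| + Σ_y |K y|·|E i y|`. [folklore] -/
theorem abs_sum_mul_le_multiscale (u : ℕ → ι → ι → ℝ) (hu : ∀ m y z, 0 ≤ u m y z) (hcol : ∀ m z, ∑ y, u m y z = 1)
    (E : ℕ → ι → ℝ) (hE : ∀ m y, E (m + 1) y = ∑ z, u m y z * E m z) (K : ι → ℝ) (ω : ℕ → ι → ℝ)
    (hω : ∀ m y z, u m y z ≠ 0 → |K z - K y| ≤ ω m z) (i : ℕ) :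
    |∑ y, K y * E 0 y| ≤ ∑ m ∈ Finset.range i, ∑ z, ω m z * |E m z| + ∑ y, |K y| * |E i y| := by
  rw [sum_mul_eq_telescope u E hE K i]
  refine (abs_add_le _ _).trans (add_le_add ?_ ?_)
  · refine (Finset.abs_sum_le_sum_abs _ _).trans (Finset.sum_le_sum fun m _ => ?_)
    exact abs_sum_mul_sub_avg_le (u m) (hu m) (hcol m) K (E m) (ω m) (hω m)
  · refine (Finset.abs_sum_le_sum_abs _ _).trans (Finset.sum_le_sum fun y _ => ?_)
    rw [abs_mul]

/-- ★★ **THE MULTISCALE PAIRING BOUND WITH SUP SIZES** (the shape LOCATE §3 sums shell by shell): if moreover `K` and the oscillations `ω m` vanish off a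
finset `s` and `|E m z| ≤ β m` on `s` for `m ≤ i` (`β m` = the scale-`m` window read as a mean), then
`|Σ_y K y·E 0 y| ≤ Σ_{m<i} β m·Σ_{z∈s} ω m z + β i·Σ_{y∈s} |K y|`. [folklore] -/
theorem abs_sum_mul_le_multiscale_sup (u : ℕ → ι → ι → ℝ) (hu : ∀ m y z, 0 ≤ u m y z) (hcol : ∀ m z, ∑ y, u m y z = 1)
    (E : ℕ → ι → ℝ) (hE : ∀ m y, E (m + 1) y = ∑ z, u m y z * E m z) (K : ι → ℝ) (ω : ℕ → ι → ℝ)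
    (hω : ∀ m y z, u m y z ≠ 0 → |K z - K y| ≤ ω m z) (i : ℕ) (s : Finset ι)
    (hω0 : ∀ m, ∀ z ∉ s, ω m z = 0) (hK0 : ∀ y ∉ s, K y = 0) (hωpos : ∀ m z, 0 ≤ ω m z)
    (β : ℕ → ℝ) (hβ : ∀ m, m ≤ i → ∀ z ∈ s, |E m z| ≤ β m) :
    |∑ y, K y * E 0 y| ≤ ∑ m ∈ Finset.range i, β m * ∑ z ∈ s, ω m z + β i * ∑ y ∈ s, |K y| := by
  classical
  refine (abs_sum_mul_le_multiscale u hu hcol E hE K ω hω i).trans (add_le_add ?_ ?_)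
  · refine Finset.sum_le_sum fun m hm => ?_
    have hmi : m ≤ i := (Finset.mem_range.mp hm).le
    -- restrict to `s` (the summand vanishes off `s`), then use the sup bound
    have hrestr : ∑ z, ω m z * |E m z| = ∑ z ∈ s, ω m z * |E m z| := by
      rw [← Finset.sum_subset (Finset.subset_univ s)]
      intro z _ hz
      rw [hω0 m z hz, zero_mul]
    rw [hrestr, Finset.mul_sum]
    refine Finset.sum_le_sum fun z hz => ?_
    rw [mul_comm]
    exact mul_le_mul_of_nonneg_right (hβ m hmi z hz) (hωpos m z)
  · have hrestr : ∑ y, |K y| * |E i y| = ∑ y ∈ s, |K y| * |E i y| := by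
      rw [← Finset.sum_subset (Finset.subset_univ s)]
      intro y _ hy
      rw [hK0 y hy, abs_zero, zero_mul]
    rw [hrestr, Finset.mul_sum]
    refine Finset.sum_le_sum fun y hy => ?_
    rw [mul_comm]
    exact mul_le_mul_of_nonneg_right (hβ i le_rfl y hy) (abs_nonneg _)

end Summit.QuantumFields.YangMills.Theorems.PoincareLipschitzMultiscalePairing

end
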